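import Summits.BirchSwinnertonDyer.BirchSwinnertonDyer.Theorems.GenusKolyvaginAtTwoTorsionCellD0PairTwistCount
import HarnessLib

/-!
# D0≤2, one genus step: square-free kernels for the rank-one twist `C₁ = E₀^{(−p₀q₁q₂)}` at `#Q₀ = 2`

Crux R″ `RankOneTwoTorsionResidualAtTwo` (stmt-27478), LINE 49 «full_vertex», stub D0≤2
`FullTorsionGenusSelmerLawUpToTwoAtTwo`, slice `#Q₀ = 2`, the twist `C₁ = E₀^{(−p₀M₀)}`, `M₀ = q₁q₂`. Setting: `E/ℚ` with
rational `2`-torsion `e₁, e₂, e₃`; `S ∋ 2` a finite set of primes off which the root differences are units and `E` has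
good reduction; three distinct primes `p, q₁, q₂ ∉ S` with `p ≡ 7 (mod 8)`, `qᵢ ≡ 3 (mod 4)`, `q₁q₂ ≡ 1 (mod 8)`,
`(−p/ℓ) = (q₁q₂/ℓ) = 1` for every odd `ℓ ∈ S` (every `ℓ ∣ 2N` splits in `ℚ(√−p)` and `ℚ(√q₁q₂)`); the twist is by
`d = −p·q₁q₂`. This file is the bookkeeping half of the `2`-descent (Silverman X.1.4 / X.4.9) for `Sel⁽²⁾(E^{(d)}/ℚ)`:

* the symbols of `d` (`v_p(d) = v_{qᵢ}(d) = 1`, `d ∈ ℚ_v^{×2}` for `v ∈ S`, `qr_{q₁}(d) = w₁ + u`,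
  `qr_{q₂}(d) = w₂ + u + 1` with `wᵢ = qr_p(qᵢ)`, `u = qr_{q₁}(q₂)`);
* **`exists_intKernel_of_mem_selmerGroup_twist_triple`**: a component `[a]` of a `p`-unramified Selmer class of the
  twist is `[m · q₁^{α₁} q₂^{α₂}]` with `m` an `S`-supported square-free integer, `αᵢ = v_{qᵢ}(a) mod 2`, and the
  reciprocity package (R1) `qr_{q₁}(m) = qr_{q₂}(m)`, (R2) `qr_p(m) = sign bit of a`, plus the expansions of
  `qr_{q₁}(a)`, `qr_{q₂}(a)`, `qr_p(a)`;
Everything is proved; no LINE 49 statement is restated; BSD is not advanced by this file alone.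

## References

* [SilvermanAEC2009] J. H. Silverman, *The Arithmetic of Elliptic Curves*, 2nd ed., GTM 106, Prop. X.1.4, X.4.9.
* [MazurRubin2010] B. Mazur, K. Rubin, Invent. Math. 181 (2010), Lemma 2.10, Lemma 2.11.
-/

noncomputable section
open scoped Classical
namespace Summit.BirchSwinnertonDyer.BirchSwinnertonDyer.Theorems.GenusKolyvaginAtTwo.TorsionCellD0

open WeierstrassCurve WeierstrassCurve.Affine WeierstrassCurve.Affine.Point
open Literature.NumberTheory.GaloisRepresentations Literature.NumberTheory.EllipticCurves Field
open Literature.NumberTheory.EllipticCurves.TwoDescentLocal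
open Literature.NumberTheory.EllipticCurves.KramerTwoDescent
open IsDedekindDomain NumberField Rat.HeightOneSpectrum

variable (E : WeierstrassCurve ℚ) [E.IsElliptic] {e₁ e₂ e₃ : ℚ}
variable (S : Finset ℕ) {p q₁ q₂ : ℕ} [hp : Fact p.Prime] [hq₁ : Fact q₁.Prime] [hq₂ : Fact q₂.Prime]

/-! ## Symbols of `d = −p q₁ q₂` -/

section Symbols

/-- `qr_q(ε ∏_{ℓ∈T} ℓ) = qr_q(ε) + Σ_{ℓ∈T} qr_q(ℓ)`. [folklore] -/
private theorem qrBit_kernel (q : ℕ) [Fact q.Prime] {ε : ℚ} {T : Finset ℕ} (hT : ∀ ℓ ∈ T, ℓ.Prime)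
    (hε : ε = 1 ∨ ε = -1) : qrBit q (ε * ∏ ℓ ∈ T, (ℓ : ℚ)) = qrBit q ε + ∑ ℓ ∈ T, qrBit q (ℓ : ℚ) := by
  have hε0 : ε ≠ 0 := by rcases hε with h | h <;> rw [h] <;> norm_num
  have hprod0 : ∀ ℓ ∈ T, (ℓ : ℚ) ≠ 0 := fun ℓ hℓ => by exact_mod_cast (hT ℓ hℓ).ne_zero
  rw [qrBit_mul q hε0 (Finset.prod_ne_zero_iff.mpr hprod0), qrBit_prod q T _ hprod0]

/-- `qr_q(q) = 0` (the unit part of `q` at `q` is `1`). [folklore] -/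
private theorem qrBit_self (q : ℕ) [hq : Fact q.Prime] : qrBit q (q : ℚ) = 0 := by
  have hq0 : (q : ℚ) ≠ 0 := by exact_mod_cast hq.out.ne_zero
  rw [qrBit, TwoDescentLocal.res, unitPart, show (q : ℚ) = ((q : ℕ) : ℚ) from rfl, padicValRat.of_nat, padicValNat_self,
    Nat.cast_one, zpow_one, div_self hq0, Rat.cast_one, if_neg]
  rw [MulChar.map_one]; norm_num

/-- `qr_q(1) = 0`. [folklore] -/
private theorem qrBit_one (q : ℕ) [Fact q.Prime] : qrBit q (1 : ℚ) = 0 := by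
  rw [show (1 : ℚ) = 1 * 1 by norm_num, qrBit_mul_self]

/-- `v_ℓ(q) = 0` for primes `ℓ ≠ q`. [folklore] -/
private theorem padicValRat_prime_of_ne {ℓ q : ℕ} [Fact ℓ.Prime] [Fact q.Prime] (h : ℓ ≠ q) :
    padicValRat ℓ (q : ℚ) = 0 := by
  rw [show (q : ℚ) = ((q : ℕ) : ℚ) from rfl, padicValRat.of_nat]; exact_mod_cast padicValNat_primes h

/-- An `S`-supported square-free kernel `ε ∏_{ℓ∈T} ℓ` as an integer. [folklore] -/
private theorem kernel_intCast {T : Finset ℕ} {ε : ℚ} (hε : ε = 1 ∨ ε = -1) :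
    ∃ m : ℤ, (m : ℚ) = ε * ∏ ℓ ∈ T, (ℓ : ℚ) ∧ ∀ q : ℕ, q.Prime → q ∉ T → (∀ ℓ ∈ T, ℓ.Prime) → ¬ (q : ℤ) ∣ m := by
  have hεZ : ∃ e : ℤ, (e : ℚ) = ε ∧ (e = 1 ∨ e = -1) := by
    rcases hε with h1 | h1
    · exact ⟨1, by rw [h1]; norm_num, Or.inl rfl⟩
    · exact ⟨-1, by rw [h1]; norm_num, Or.inr rfl⟩
  obtain ⟨e, he, he1⟩ := hεZ
  refine ⟨e * ∏ ℓ ∈ T, (ℓ : ℤ), by rw [← he]; push_cast; rfl, ?_⟩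
  intro q hq hqT hTp hdvd
  have hqprime : Prime (q : ℤ) := Nat.prime_iff_prime_int.mp hq
  rcases hqprime.dvd_or_dvd hdvd with h1 | h2
  · rcases he1 with rfl | rfl
    · exact hq.ne_one (by exact_mod_cast Int.eq_one_of_dvd_one (by positivity) h1)
    · exact hq.ne_one (by exact_mod_cast Int.eq_one_of_dvd_one (by positivity) (Int.dvd_neg.mp h1))
  · obtain ⟨ℓ, hℓT, hℓ⟩ := (Prime.dvd_finsetProd_iff hqprime _).mp h2
    have := (Nat.prime_dvd_prime_iff_eq hq (hTp ℓ hℓT)).mp (Int.natCast_dvd_natCast.mp hℓ)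
    exact hqT (this ▸ hℓT)

/-- A prime is nonzero in `ℚ`. [folklore] -/
private theorem castPrime_ne_zero (q : ℕ) [hq : Fact q.Prime] : (q : ℚ) ≠ 0 := by exact_mod_cast hq.out.ne_zero

/-- `v_p(−p q₁ q₂) = 1`. [folklore] -/
theorem padicValRat_negTriple_p (hpq₁ : p ≠ q₁) (hpq₂ : p ≠ q₂) :
    padicValRat p (-(p : ℚ) * ((q₁ : ℚ) * q₂)) = 1 := by
  rw [neg_mul, padicValRat.neg, padicValRat.mul (castPrime_ne_zero p) (mul_ne_zero (castPrime_ne_zero q₁) (castPrime_ne_zero q₂)),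
    padicValRat.mul (castPrime_ne_zero q₁) (castPrime_ne_zero q₂),
    padicValRat.self hp.out.one_lt, padicValRat_prime_of_ne hpq₁, padicValRat_prime_of_ne hpq₂]; simp

/-- `v_{q₁}(−p q₁ q₂) = 1`. [folklore] -/
theorem padicValRat_negTriple_q₁ (hpq₁ : p ≠ q₁) (hne : q₁ ≠ q₂) :
    padicValRat q₁ (-(p : ℚ) * ((q₁ : ℚ) * q₂)) = 1 := by
  rw [neg_mul, padicValRat.neg, padicValRat.mul (castPrime_ne_zero p) (mul_ne_zero (castPrime_ne_zero q₁) (castPrime_ne_zero q₂)),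
    padicValRat.mul (castPrime_ne_zero q₁) (castPrime_ne_zero q₂),
    padicValRat.self hq₁.out.one_lt, padicValRat_prime_of_ne (Ne.symm hpq₁), padicValRat_prime_of_ne hne]; simp

/-- `v_{q₂}(−p q₁ q₂) = 1`. [folklore] -/
theorem padicValRat_negTriple_q₂ (hpq₂ : p ≠ q₂) (hne : q₁ ≠ q₂) :
    padicValRat q₂ (-(p : ℚ) * ((q₁ : ℚ) * q₂)) = 1 := by
  rw [neg_mul, padicValRat.neg, padicValRat.mul (castPrime_ne_zero p) (mul_ne_zero (castPrime_ne_zero q₁) (castPrime_ne_zero q₂)),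
    padicValRat.mul (castPrime_ne_zero q₁) (castPrime_ne_zero q₂),
    padicValRat.self hq₂.out.one_lt, padicValRat_prime_of_ne (Ne.symm hpq₂), padicValRat_prime_of_ne (Ne.symm hne)]; simp

/-- `v_ℓ(−p q₁ q₂) = 0` for primes `ℓ ∉ {p, q₁, q₂}`. [folklore] -/
theorem padicValRat_negTriple_of_ne {ℓ : ℕ} [Fact ℓ.Prime] (hℓp : ℓ ≠ p) (hℓ₁ : ℓ ≠ q₁) (hℓ₂ : ℓ ≠ q₂) :
    padicValRat ℓ (-(p : ℚ) * ((q₁ : ℚ) * q₂)) = 0 := by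
  rw [neg_mul, padicValRat.neg, padicValRat.mul (castPrime_ne_zero p) (mul_ne_zero (castPrime_ne_zero q₁) (castPrime_ne_zero q₂)),
    padicValRat.mul (castPrime_ne_zero q₁) (castPrime_ne_zero q₂),
    padicValRat_prime_of_ne hℓp, padicValRat_prime_of_ne hℓ₁, padicValRat_prime_of_ne hℓ₂]; simp

/-- The root differences of `E^{(−pq₁q₂)}` are units off `S ∪ {p, q₁, q₂}`. [folklore] -/
theorem padicValRat_negTriple_sub (h : E.toAffine.SplitTwoTorsion e₁ e₂ e₃)
    (hgood : ∀ ℓ : ℕ, (hℓ : ℓ.Prime) → ℓ ∉ S → haveI : Fact ℓ.Prime := ⟨hℓ⟩;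
      padicValRat ℓ (e₁ - e₂) = 0 ∧ padicValRat ℓ (e₁ - e₃) = 0 ∧ padicValRat ℓ (e₂ - e₃) = 0)
    (ℓ : ℕ) (hℓ : ℓ.Prime) (hℓS : ℓ ∉ insert p (insert q₁ (insert q₂ S))) :
    haveI : Fact ℓ.Prime := ⟨hℓ⟩
    padicValRat ℓ (-(p : ℚ) * ((q₁ : ℚ) * q₂) * e₁ - -(p : ℚ) * ((q₁ : ℚ) * q₂) * e₂) = 0 ∧
      padicValRat ℓ (-(p : ℚ) * ((q₁ : ℚ) * q₂) * e₁ - -(p : ℚ) * ((q₁ : ℚ) * q₂) * e₃) = 0 ∧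
      padicValRat ℓ (-(p : ℚ) * ((q₁ : ℚ) * q₂) * e₂ - -(p : ℚ) * ((q₁ : ℚ) * q₂) * e₃) = 0 := by
  haveI : Fact ℓ.Prime := ⟨hℓ⟩
  simp only [Finset.mem_insert, not_or] at hℓS
  obtain ⟨hℓp, hℓ₁, hℓ₂, hℓS⟩ := hℓS
  obtain ⟨h12, h13, h23⟩ := hgood ℓ hℓ hℓS
  have hd := padicValRat_negTriple_of_ne (p := p) (q₁ := q₁) (q₂ := q₂) hℓp hℓ₁ hℓ₂
  have hd0 : -(p : ℚ) * ((q₁ : ℚ) * q₂) ≠ 0 :=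
    mul_ne_zero (neg_ne_zero.mpr (castPrime_ne_zero p)) (mul_ne_zero (castPrime_ne_zero q₁) (castPrime_ne_zero q₂))
  refine ⟨?_, ?_, ?_⟩
  · rw [← mul_sub, padicValRat.mul hd0 (sub_ne_zero.mpr h.ne₁₂), hd, h12, add_zero]
  · rw [← mul_sub, padicValRat.mul hd0 (sub_ne_zero.mpr h.ne₁₃), hd, h13, add_zero]
  · rw [← mul_sub, padicValRat.mul hd0 (sub_ne_zero.mpr h.ne₂₃), hd, h23, add_zero]

/-- `−p q₁ q₂` is a square in `ℚ_v` for every `v ∈ S` (split conditions at the primes of `S ∋ 2`). [folklore] -/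
theorem isSquare_negTriple_adicCompletion (hpS : p ∉ S) (hq₁S : q₁ ∉ S) (hq₂S : q₂ ∉ S) (hp8 : p % 8 = 7)
    (hq₁4 : q₁ % 4 = 3) (hq₂4 : q₂ % 4 = 3) (hM8 : ((q₁ : ℤ) * q₂) % 8 = 1)
    (hsplitp : ∀ ℓ ∈ S, (hℓ : ℓ.Prime) → ℓ ≠ 2 → haveI : Fact ℓ.Prime := ⟨hℓ⟩; legendreSym ℓ (-(p : ℤ)) = 1)
    (hsplitM : ∀ ℓ ∈ S, (hℓ : ℓ.Prime) → ℓ ≠ 2 → haveI : Fact ℓ.Prime := ⟨hℓ⟩; legendreSym ℓ ((q₁ : ℤ) * q₂) = 1)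
    (v : HeightOneSpectrum (𝓞 ℚ)) (hvS : (primesEquiv v : ℕ) ∈ S) :
    IsSquare (algebraMap ℚ (v.adicCompletion ℚ) (-(p : ℚ) * ((q₁ : ℚ) * q₂))) := by
  rw [map_mul]
  by_cases hv2 : (primesEquiv v : ℕ) = 2
  · exact (isSquare_neg_prime_adicCompletion_two (p := p) hp8 v hv2).mul
      (isSquare_mul_adicCompletion_two (q₁ := q₁) (q₂ := q₂) hq₁4 hq₂4 hM8 v hv2)
  · haveI : Fact (primesEquiv v : ℕ).Prime := ⟨(primesEquiv v).2⟩
    have hℓp : (primesEquiv v : ℕ) ≠ p := fun h => hpS (h ▸ hvS)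
    have hℓ₁ : (primesEquiv v : ℕ) ≠ q₁ := fun h => hq₁S (h ▸ hvS)
    have hℓ₂ : (primesEquiv v : ℕ) ≠ q₂ := fun h => hq₂S (h ▸ hvS)
    exact (isSquare_neg_prime_adicCompletion_odd (p := p) v rfl hv2 hℓp (hsplitp _ hvS (primesEquiv v).2 hv2)).mul
      (isSquare_mul_adicCompletion_of_legendreSym (q₁ := q₁) (q₂ := q₂) v rfl hv2 hℓ₁ hℓ₂
        (hsplitM _ hvS (primesEquiv v).2 hv2))

/-- A bit identity in `ℤ/2`: `1 + (x + 1) = x`. [folklore] -/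
private theorem one_add_add_one (x : ZMod 2) : 1 + (x + 1) = x := by revert x; decide

/-- **`qr_{q₁}(−pq₁q₂) = qr_p(q₁) + qr_{q₁}(q₂)`** (`= w₁ + u`; quadratic reciprocity for `p ≡ q₁ ≡ 3 (mod 4)`).
[folklore] -/
theorem qrBit_negTriple_q₁ (hpq₁ : p ≠ q₁) (hp8 : p % 8 = 7) (hq₁4 : q₁ % 4 = 3) :
    qrBit q₁ (-(p : ℚ) * ((q₁ : ℚ) * q₂)) = qrBit p (q₁ : ℚ) + qrBit q₁ (q₂ : ℚ) := by
  have hp4 : p % 4 = 3 := by omega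
  have hp0 : (p : ℚ) ≠ 0 := by exact_mod_cast hp.out.ne_zero
  have hq₁0 : (q₁ : ℚ) ≠ 0 := by exact_mod_cast hq₁.out.ne_zero
  have hq₂0 : (q₂ : ℚ) ≠ 0 := by exact_mod_cast hq₂.out.ne_zero
  rw [qrBit_mul q₁ (neg_ne_zero.mpr hp0) (mul_ne_zero hq₁0 hq₂0), qrBit_mul q₁ hq₁0 hq₂0, qrBit_self,
    show (-(p : ℚ)) = (-1) * p by ring, qrBit_mul q₁ (by norm_num) hp0, qrBit_neg_one_eq_one_of_emod_four hq₁4,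
    qrBit_swap_eq_add_one hp4 hq₁4 hpq₁, one_add_add_one, zero_add]

/-- **`qr_{q₂}(−pq₁q₂) = qr_p(q₂) + qr_{q₁}(q₂) + 1`** (`= w₂ + u + 1`). [folklore] -/
theorem qrBit_negTriple_q₂ (hpq₂ : p ≠ q₂) (hne : q₁ ≠ q₂) (hp8 : p % 8 = 7) (hq₁4 : q₁ % 4 = 3) (hq₂4 : q₂ % 4 = 3) :
    qrBit q₂ (-(p : ℚ) * ((q₁ : ℚ) * q₂)) = qrBit p (q₂ : ℚ) + qrBit q₁ (q₂ : ℚ) + 1 := by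
  have hp4 : p % 4 = 3 := by omega
  have hp0 : (p : ℚ) ≠ 0 := by exact_mod_cast hp.out.ne_zero
  have hq₁0 : (q₁ : ℚ) ≠ 0 := by exact_mod_cast hq₁.out.ne_zero
  have hq₂0 : (q₂ : ℚ) ≠ 0 := by exact_mod_cast hq₂.out.ne_zero
  rw [qrBit_mul q₂ (neg_ne_zero.mpr hp0) (mul_ne_zero hq₁0 hq₂0), qrBit_mul q₂ hq₁0 hq₂0, qrBit_self,
    show (-(p : ℚ)) = (-1) * p by ring, qrBit_mul q₂ (by norm_num) hp0, qrBit_neg_one_eq_one_of_emod_four hq₂4,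
    qrBit_swap_eq_add_one hp4 hq₂4 hpq₂, qrBit_swap_eq_add_one hq₁4 hq₂4 hne, one_add_add_one, add_zero, add_assoc]
end Symbols

/-! ## Square-free kernels of a `p`-unramified Selmer class of `E^{(−pq₁q₂)}` -/

section Kernel

/-- A product over a kernel set `T ⊆ S ∪ {p, q₁, q₂}` with `p ∉ T` splits into its `S`-part and its `{q₁, q₂}`-part.
[folklore] -/
private theorem prod_kernel_split {T : Finset ℕ} (hT : T ⊆ insert p (insert q₁ (insert q₂ S))) (hpT : p ∉ T)
    (hq₁S : q₁ ∉ S) (hq₂S : q₂ ∉ S) (hne : q₁ ≠ q₂) {M : Type*} [CommMonoid M] (f : ℕ → M) :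
    ∏ ℓ ∈ T, f ℓ = (∏ ℓ ∈ T.filter (· ∈ S), f ℓ) * ((if q₁ ∈ T then f q₁ else 1) * (if q₂ ∈ T then f q₂ else 1)) := by
  rw [← Finset.prod_filter_mul_prod_filter_not T (· ∈ S)]
  congr 1
  have hU : T.filter (fun ℓ => ¬ ℓ ∈ S) ⊆ {q₁, q₂} := by
    intro ℓ hℓ
    rw [Finset.mem_filter] at hℓ
    have := hT hℓ.1
    simp only [Finset.mem_insert, Finset.mem_singleton] at this ⊢
    rcases this with rfl | rfl | rfl | h3
    · exact absurd hℓ.1 hpT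
    · exact Or.inl rfl
    · exact Or.inr rfl
    · exact absurd h3 hℓ.2
  have step : ∏ ℓ ∈ T.filter (fun ℓ => ¬ ℓ ∈ S), f ℓ =
      ∏ ℓ ∈ T.filter (fun ℓ => ¬ ℓ ∈ S), (if ℓ ∈ T then f ℓ else 1) :=
    Finset.prod_congr rfl fun ℓ hℓ => by rw [if_pos (Finset.mem_filter.mp hℓ).1]
  rw [step, Finset.prod_subset hU (fun x hx hxU => ?_), Finset.prod_pair hne]
  -- `x ∈ {q₁, q₂} ∖ U`: then `x ∉ T`
  have hxS : x ∉ S := by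
    simp only [Finset.mem_insert, Finset.mem_singleton] at hx
    rcases hx with rfl | rfl
    · exact hq₁S
    · exact hq₂S
  have hxT : x ∉ T := fun hxT => hxU (Finset.mem_filter.mpr ⟨hxT, hxS⟩)
  rw [if_neg hxT]

/-- Additive form of `prod_kernel_split` (for sums of residue bits). [folklore] -/
private theorem sum_kernel_split {T : Finset ℕ} (hT : T ⊆ insert p (insert q₁ (insert q₂ S))) (hpT : p ∉ T)
    (hq₁S : q₁ ∉ S) (hq₂S : q₂ ∉ S) (hne : q₁ ≠ q₂) {M : Type*} [AddCommMonoid M] (f : ℕ → M) :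
    ∑ ℓ ∈ T, f ℓ = (∑ ℓ ∈ T.filter (· ∈ S), f ℓ) + ((if q₁ ∈ T then f q₁ else 0) + (if q₂ ∈ T then f q₂ else 0)) := by
  rw [← Finset.sum_filter_add_sum_filter_not T (· ∈ S)]
  congr 1
  have hU : T.filter (fun ℓ => ¬ ℓ ∈ S) ⊆ {q₁, q₂} := by
    intro ℓ hℓ
    rw [Finset.mem_filter] at hℓ
    have := hT hℓ.1
    simp only [Finset.mem_insert, Finset.mem_singleton] at this ⊢
    rcases this with rfl | rfl | rfl | h3
    · exact absurd hℓ.1 hpT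
    · exact Or.inl rfl
    · exact Or.inr rfl
    · exact absurd h3 hℓ.2
  have step : ∑ ℓ ∈ T.filter (fun ℓ => ¬ ℓ ∈ S), f ℓ =
      ∑ ℓ ∈ T.filter (fun ℓ => ¬ ℓ ∈ S), (if ℓ ∈ T then f ℓ else 0) :=
    Finset.sum_congr rfl fun ℓ hℓ => by rw [if_pos (Finset.mem_filter.mp hℓ).1]
  rw [step, Finset.sum_subset hU (fun x hx hxU => ?_), Finset.sum_pair hne]
  have hxS : x ∉ S := by
    simp only [Finset.mem_insert, Finset.mem_singleton] at hx
    rcases hx with rfl | rfl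
    · exact hq₁S
    · exact hq₂S
  have hxT : x ∉ T := fun hxT => hxU (Finset.mem_filter.mpr ⟨hxT, hxS⟩)
  rw [if_neg hxT]

/-- `qr_{q₁}(ε) = qr_{q₂}(ε)` for a sign `ε` when both `qr_{qᵢ}(−1) = 1`. [folklore] -/
private theorem qrBit_sign_eq' {q q' : ℕ} [Fact q.Prime] [Fact q'.Prime] {ε : ℚ} (hε : ε = 1 ∨ ε = -1)
    (h₁ : qrBit q (-1 : ℚ) = 1) (h₂ : qrBit q' (-1 : ℚ) = 1) : qrBit q ε = qrBit q' ε := by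
  rcases hε with h | h
  · rw [h, qrBit_one, qrBit_one]
  · rw [h, h₁, h₂]

/-- **Square-free kernel of a component of a `p`-unramified Selmer class of `E^{(−pq₁q₂)}`** (setting of the module
docstring). If `c ∈ Sel⁽²⁾(E^{(d)}/ℚ)`, `d = −pq₁q₂`, has `h`-component `[a]` with `v_p(a)` even, then
`[a] = [m · q₁^{α₁} · q₂^{α₂}]` in `ℚˣ/ℚˣ²` with `αᵢ = v_{qᵢ}(a) mod 2` and `m ≠ 0` an integer all of whose prime
factors lie in `S`, `sign m = sign a`, satisfying (R1) `qr_{q₂}(m) = qr_{q₁}(m)`, (R2) `qr_p(m) = [a < 0]`, and the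
expansions `qr_{q₁}(a) = qr_{q₁}(m) + α₂u`, `qr_{q₂}(a) = qr_{q₁}(m) + α₁(u+1)`, `qr_p(a) = qr_p(m) + α₁w₁ + α₂w₂`
(`u = qr_{q₁}(q₂)`, `wᵢ = qr_p(qᵢ)`). [cite: SilvermanAEC2009, Prop. X.1.4, Prop. X.4.9]
[cite: MazurRubin2010, Lemma 2.10] -/
theorem exists_intKernel_of_mem_selmerGroup_twist_triple {a₁ a₂ a₃ : ℚ} (h : E.toAffine.SplitTwoTorsion a₁ a₂ a₃)
    (hS : ∀ q ∈ S, q.Prime)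
    (hgood : ∀ ℓ : ℕ, (hℓ : ℓ.Prime) → ℓ ∉ S → haveI : Fact ℓ.Prime := ⟨hℓ⟩;
      padicValRat ℓ (a₁ - a₂) = 0 ∧ padicValRat ℓ (a₁ - a₃) = 0)
    (hpS : p ∉ S) (hq₁S : q₁ ∉ S) (hq₂S : q₂ ∉ S) (hpq₁ : p ≠ q₁) (hpq₂ : p ≠ q₂) (hne : q₁ ≠ q₂)
    (hp8 : p % 8 = 7) (hq₁4 : q₁ % 4 = 3) (hq₂4 : q₂ % 4 = 3) (hM8 : ((q₁ : ℤ) * q₂) % 8 = 1)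
    (hsplitp : ∀ ℓ ∈ S, (hℓ : ℓ.Prime) → ℓ ≠ 2 → haveI : Fact ℓ.Prime := ⟨hℓ⟩; legendreSym ℓ (-(p : ℤ)) = 1)
    (hsplitM : ∀ ℓ ∈ S, (hℓ : ℓ.Prime) → ℓ ≠ 2 → haveI : Fact ℓ.Prime := ⟨hℓ⟩; legendreSym ℓ ((q₁ : ℤ) * q₂) = 1)
    {d : ℚ} (hd : d = -(p : ℚ) * ((q₁ : ℚ) * q₂)) [(E.quadraticTwist d).IsElliptic]
    {c : galH1Torsion (E.quadraticTwist d) 2} (hc : c ∈ selmerGroup (E.quadraticTwist d) 2) (a : ℚˣ)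
    (ha : kummerEquiv ℚ 2 ((E.quadraticTwist d).twoTorsionCharH1 (h.quadraticTwist d) c) =
      Additive.ofMul (QuotientGroup.mk a))
    (hpa : parityBit p (a : ℚ) = 0) :
    ∃ m : ℤ, (m : ℚ) ≠ 0 ∧ (∀ ℓ : ℕ, ℓ.Prime → ℓ ∉ S → ¬ (ℓ : ℤ) ∣ m) ∧ (0 < (m : ℚ) ↔ 0 < (a : ℚ)) ∧
      (∃ hg : (m : ℚ) * ((if parityBit q₁ (a : ℚ) = 1 then (q₁ : ℚ) else 1) *
          (if parityBit q₂ (a : ℚ) = 1 then (q₂ : ℚ) else 1)) ≠ 0,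
        (QuotientGroup.mk a : SqUnits ℚ) = QuotientGroup.mk (Units.mk0 _ hg)) ∧
      qrBit q₂ (m : ℚ) = qrBit q₁ (m : ℚ) ∧
      qrBit p (m : ℚ) = (if 0 < (a : ℚ) then 0 else 1) ∧
      qrBit q₁ (a : ℚ) = qrBit q₁ (m : ℚ) + parityBit q₂ (a : ℚ) * qrBit q₁ (q₂ : ℚ) ∧
      qrBit q₂ (a : ℚ) = qrBit q₁ (m : ℚ) + parityBit q₁ (a : ℚ) * (qrBit q₁ (q₂ : ℚ) + 1) ∧
      qrBit p (a : ℚ) = qrBit p (m : ℚ) + parityBit q₁ (a : ℚ) * qrBit p (q₁ : ℚ) +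
        parityBit q₂ (a : ℚ) * qrBit p (q₂ : ℚ) := by
  subst hd
  have h' := h.quadraticTwist (-(p : ℚ) * ((q₁ : ℚ) * q₂))
  have hp0 : (p : ℚ) ≠ 0 := by exact_mod_cast hp.out.ne_zero
  have hq₁0 : (q₁ : ℚ) ≠ 0 := by exact_mod_cast hq₁.out.ne_zero
  have hq₂0 : (q₂ : ℚ) ≠ 0 := by exact_mod_cast hq₂.out.ne_zero
  have hd0 : -(p : ℚ) * ((q₁ : ℚ) * q₂) ≠ 0 := mul_ne_zero (neg_ne_zero.mpr hp0) (mul_ne_zero hq₁0 hq₂0)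
  -- kernel relative to `S' = S ∪ {p, q₁, q₂}`
  set S' : Finset ℕ := insert p (insert q₁ (insert q₂ S)) with hS'
  have hS'p : ∀ q ∈ S', q.Prime := fun q hq => by
    simp only [hS', Finset.mem_insert] at hq
    rcases hq with rfl | rfl | rfl | hq
    · exact hp.out
    · exact hq₁.out
    · exact hq₂.out
    · exact hS q hq
  have hgood' : ∀ ℓ : ℕ, (hℓ : ℓ.Prime) → ℓ ∉ S' → haveI : Fact ℓ.Prime := ⟨hℓ⟩;
      padicValRat ℓ (-(p : ℚ) * ((q₁ : ℚ) * q₂) * a₁ - -(p : ℚ) * ((q₁ : ℚ) * q₂) * a₂) = 0 ∧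
        padicValRat ℓ (-(p : ℚ) * ((q₁ : ℚ) * q₂) * a₁ - -(p : ℚ) * ((q₁ : ℚ) * q₂) * a₃) = 0 := by
    intro ℓ hℓ hℓS'
    haveI : Fact ℓ.Prime := ⟨hℓ⟩
    simp only [hS', Finset.mem_insert, not_or] at hℓS'
    obtain ⟨hℓp, hℓ₁, hℓ₂, hℓS⟩ := hℓS'
    obtain ⟨g12, g13⟩ := hgood ℓ hℓ hℓS
    have hv := padicValRat_negTriple_of_ne (p := p) (q₁ := q₁) (q₂ := q₂) hℓp hℓ₁ hℓ₂
    exact ⟨by rw [← mul_sub, padicValRat.mul hd0 (sub_ne_zero.mpr h.ne₁₂), hv, g12, add_zero],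
      by rw [← mul_sub, padicValRat.mul hd0 (sub_ne_zero.mpr h.ne₁₃), hv, g13, add_zero]⟩
  obtain ⟨T, hTS', ε, hε, hεpos, hg, hmk, hpar, -⟩ :=
    (E.quadraticTwist (-(p : ℚ) * ((q₁ : ℚ) * q₂))).exists_kernel_of_mem_selmerGroup h' S' hS'p hgood' hc a ha
  have hTp : ∀ ℓ ∈ T, ℓ.Prime := fun ℓ hℓ => hS'p ℓ (hTS' hℓ)
  have hε0 : ε ≠ 0 := by rcases hε with h1 | h1 <;> rw [h1] <;> norm_num
  have hpT : p ∉ T := fun hT => by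
    have := hpar p; rw [if_pos hT] at this; rw [this] at hpa; exact one_ne_zero hpa
  -- the `S`-part of the kernel, as an integer
  have hT₀S : T.filter (· ∈ S) ⊆ S := fun ℓ hℓ => (Finset.mem_filter.mp hℓ).2
  have hT₀p : ∀ ℓ ∈ T.filter (· ∈ S), ℓ.Prime := fun ℓ hℓ => hS ℓ (hT₀S hℓ)
  obtain ⟨m, hm, hmdiv⟩ := kernel_intCast (T := T.filter (· ∈ S)) hε
  have hprod0 : (0 : ℚ) < ∏ ℓ ∈ T.filter (· ∈ S), (ℓ : ℚ) :=
    Finset.prod_pos fun ℓ hℓ => by exact_mod_cast (hT₀p ℓ hℓ).pos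
  have hm0 : (m : ℚ) ≠ 0 := by rw [hm]; exact mul_ne_zero hε0 hprod0.ne'
  -- parities at `q₁, q₂` are the membership bits
  have hα₁ : (if parityBit q₁ (a : ℚ) = 1 then (q₁ : ℚ) else 1) = (if q₁ ∈ T then (q₁ : ℚ) else 1) := by
    rw [hpar q₁]; by_cases h1 : q₁ ∈ T
    · rw [if_pos h1, if_pos rfl, if_pos h1]
    · rw [if_neg h1, if_neg zero_ne_one, if_neg h1]
  have hα₂ : (if parityBit q₂ (a : ℚ) = 1 then (q₂ : ℚ) else 1) = (if q₂ ∈ T then (q₂ : ℚ) else 1) := by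
    rw [hpar q₂]; by_cases h1 : q₂ ∈ T
    · rw [if_pos h1, if_pos rfl, if_pos h1]
    · rw [if_neg h1, if_neg zero_ne_one, if_neg h1]
  have hsplit_prod := prod_kernel_split S (p := p) hTS' hpT hq₁S hq₂S hne (fun ℓ => (ℓ : ℚ))
  have hker : ε * ∏ ℓ ∈ T, (ℓ : ℚ) =
      (m : ℚ) * ((if parityBit q₁ (a : ℚ) = 1 then (q₁ : ℚ) else 1) * (if parityBit q₂ (a : ℚ) = 1 then (q₂ : ℚ) else 1)) := by
    rw [hsplit_prod, hm, hα₁, hα₂, mul_assoc]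
  have hg' : (m : ℚ) * ((if parityBit q₁ (a : ℚ) = 1 then (q₁ : ℚ) else 1) *
      (if parityBit q₂ (a : ℚ) = 1 then (q₂ : ℚ) else 1)) ≠ 0 := by rw [← hker]; exact hg
  -- (R1), (R2) on the primes of `S`
  have hm1₁ := qrBit_neg_one_eq_one_of_emod_four hq₁4
  have hm1₂ := qrBit_neg_one_eq_one_of_emod_four hq₂4
  have hR1 : ∀ ℓ ∈ S, qrBit q₁ (ℓ : ℚ) = qrBit q₂ (ℓ : ℚ) := by
    intro ℓ hℓ
    by_cases hℓ2 : ℓ = 2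
    · subst hℓ2; exact_mod_cast qrBit_two_eq_qrBit_two_of_mul_emod_eight hq₁4 hq₂4 hM8
    · exact qrBit_eq_qrBit_of_legendreSym_mul_eq_one hq₁4 hq₂4 (hS ℓ hℓ) hℓ2 (fun h => hq₁S (h ▸ hℓ))
        (fun h => hq₂S (h ▸ hℓ)) (hsplitM ℓ hℓ (hS ℓ hℓ) hℓ2)
  have hR2 : ∀ ℓ ∈ S, qrBit p (ℓ : ℚ) = 0 := by
    intro ℓ hℓ
    by_cases hℓ2 : ℓ = 2
    · rw [hℓ2]; exact_mod_cast qrBit_two_eq_zero hp8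
    · exact qrBit_prime_eq_zero_of_legendreSym hp8 (hS ℓ hℓ) hℓ2 (fun h => hpS (h ▸ hℓ)) (hsplitp ℓ hℓ (hS ℓ hℓ) hℓ2)
  have hqm : ∀ (q : ℕ) [Fact q.Prime], qrBit q (m : ℚ) = qrBit q ε + ∑ ℓ ∈ T.filter (· ∈ S), qrBit q (ℓ : ℚ) := by
    intro q _; rw [hm]; exact qrBit_kernel q hT₀p hε
  have hR1m : qrBit q₂ (m : ℚ) = qrBit q₁ (m : ℚ) := by
    rw [hqm q₁, hqm q₂, qrBit_sign_eq' hε hm1₂ hm1₁]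
    congr 1
    exact Finset.sum_congr rfl fun ℓ hℓ => (hR1 ℓ (hT₀S hℓ)).symm
  -- the expansion of `qr_q(a)` for any prime `q`
  have hexp : ∀ (q : ℕ) [Fact q.Prime], qrBit q (a : ℚ) =
      qrBit q (m : ℚ) + ((if q₁ ∈ T then qrBit q (q₁ : ℚ) else 0) + (if q₂ ∈ T then qrBit q (q₂ : ℚ) else 0)) := by
    intro q _
    rw [qrBit_eq_of_mk_eq q hmk, Units.val_mk0, qrBit_kernel q hTp hε,
      sum_kernel_split S (p := p) hTS' hpT hq₁S hq₂S hne (fun ℓ => qrBit q (ℓ : ℚ)), hqm q, add_assoc]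
  have hb₁ : ∀ x : ZMod 2, (if q₁ ∈ T then x else 0) = parityBit q₁ (a : ℚ) * x := fun x => by
    rw [hpar q₁]; split_ifs <;> simp
  have hb₂ : ∀ x : ZMod 2, (if q₂ ∈ T then x else 0) = parityBit q₂ (a : ℚ) * x := fun x => by
    rw [hpar q₂]; split_ifs <;> simp
  refine ⟨m, hm0, fun ℓ hℓ hℓS => hmdiv ℓ hℓ (fun hT => hℓS (hT₀S hT)) hT₀p, ?_, ⟨hg', ?_⟩, hR1m, ?_, ?_, ?_, ?_⟩
  · -- sign
    rw [← hεpos, hm]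
    constructor
    · intro hpos
      rcases hε with h1 | h1
      · exact h1
      · rw [h1] at hpos; linarith
    · intro h1; rw [h1, one_mul]; exact hprod0
  · -- the class
    rw [hmk]; congr 1; exact Units.ext (by rw [Units.val_mk0, Units.val_mk0, hker])
  · -- (R2)
    rw [hqm p, Finset.sum_eq_zero (fun ℓ hℓ => hR2 ℓ (hT₀S hℓ)), add_zero]
    rcases hε with h1 | h1
    · rw [h1, qrBit_one, if_pos (hεpos.mp h1)]
    · have hna : ¬ (0 : ℚ) < a := fun hpos => by rw [hεpos.mpr hpos] at h1; norm_num at h1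
      rw [h1, qrBit_neg_one_eq_one hp8, if_neg hna]
  · -- expansion at `q₁`
    rw [hexp q₁, qrBit_self, hb₂]
    split_ifs <;> simp
  · -- expansion at `q₂`
    rw [hexp q₂, qrBit_self, qrBit_swap_eq_add_one hq₁4 hq₂4 hne, hb₁, hR1m]
    split_ifs <;> simp
  · -- expansion at `p`
    rw [hexp p, hb₁, hb₂, add_assoc]

end Kernel

end Summit.BirchSwinnertonDyer.BirchSwinnertonDyer.Theorems.GenusKolyvaginAtTwo.TorsionCellD0

end
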